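import Summits.CriticalPhenomena.CardyFormulaZ2.Theorems.CardyIKTransportIKLinearTransportFarRSWRingEmpty
import Summits.CriticalPhenomena.CardyFormulaZ2.Theorems.CardyIKTransportIKLinearTransportFarRSWOfInputsPrep

/-!
# `CardyIKTransport.IKLinearTransport` (stmt-CriticalPhenomena-5076), line `pinned-diagram-exchange`:
# the RING clause of `stub_IKFarRSW` on HONEYCOMB column strips (registered sub-goal `ikFarRSW_ring_hon`)

`stub_IKFarRSW` asks, for every aspect bound `k`, every column pattern `S` and every `w × h` box with
`n ≤ w, h ≤ k n`, a black RING in dual form with `ν_S`-probability `≥ c_k`: every WHITE monochromatic path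
(`monoPaths x false`) meeting the box `[a, a+w) × [b, b+h)` stays off `farFrom a b w h n`. The `S = ∅`
member (site percolation on `𝕋`) is `FarRSWFragments.ikFarRSW_ring_empty` (file `…FarRSWRingEmpty`). THIS
FILE transfers it to every pattern `S` whose columns `a-n-1 … a+w+n` are honeycomb (`∉ S`), by the
column-strip Markov property `stripLaw` (file `…TransportDefs`):

* LOCALITY (`ring_mem_determinedOn_colStrip`): the ring event is determined by the cells and faces of the
  column strip `colStrip (a-n-1) (a+w+n)`. Its complement is witnessed by a white chain from a box cell to
  its FIRST far cell (`frsw_exists_short_witness` of `…FarRSWOfInputsPrep`); all cells of such a chain but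
  the last are non-far (columns `a-n … a+w+n-1`) and the last is a neighbour of a non-far cell (columns
  `a-n-1 … a+w+n`, `frsw_cellGraph_adj_coord`), so the chain and the faces below its cells lie in the strip
  and `Lift.monoPaths_congr` transports it between configurations agreeing there.
* MEASURABILITY (`ring_measurableSet`): the ring event is determined by a finite box
  (`farRSW_ring_mem_determinedOn`), hence measurable (`frsw_measurableSet_of_determinedOn_box`).
* TRANSFER (`ring_nuMix_eq_of_hon`, `ikFarRSW_ring_hon`): `stripLaw S ∅` on the strip, then the constant of
  `ikFarRSW_ring_empty k`.

No definitions, no literature facts, no `sorry`.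
-/

noncomputable section

namespace Summit.CriticalPhenomena.CardyFormulaZ2.Theorems.IKLinearTransport.PinnedDiagramExchange.FarRSWFragments

open Summit.CriticalPhenomena.CardyFormulaZ2.Theorems.IKLinearTransport.PinnedDiagramExchange
open scoped Classical ENNReal
open Set MeasureTheory
open Literature.Probability.Percolation Literature.Probability.LatticeModels

/-! ## §1 Locality: the ring event is read on the column strip `a-n-1 … a+w+n` -/

/-- TRANSFER OF RING WITNESSES along agreement on the column strip `a-d-1 … a+w+d`: if `x` and `y` agree on
the cells and faces of these columns and some white path of `x` joins the `w × h` box at `(a, b)` to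
`farFrom a b w h d`, so does some white path of `y` (cut the path at its first far cell; the short witness
lies in the strip together with the faces below its cells). [folklore] -/
theorem ring_witness_transfer_colStrip {a b : ℤ} {w h d : ℕ} {x y : Obs}
    (hxy : Lift.Agree (colStrip (a - d - 1) (a + w + d)) x y)
    (hx : ∃ p ∈ monoPaths x false, (∃ u ∈ p, a ≤ u 0 ∧ u 0 < a + w ∧ b ≤ u 1 ∧ u 1 < b + h) ∧
      ∃ v ∈ p, v ∈ farFrom a b w h d) :
    ∃ p ∈ monoPaths y false, (∃ u ∈ p, a ≤ u 0 ∧ u 0 < a + w ∧ b ≤ u 1 ∧ u 1 < b + h) ∧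
      ∃ v ∈ p, v ∈ farFrom a b w h d := by
  obtain ⟨p, hp, ⟨u, hu, huB⟩, v, hv, hvF⟩ := hx
  obtain ⟨q, hqne, hqc, hqsub, hqN, hqB, hqF⟩ := frsw_exists_short_witness (cellGraph x.2)
    (F := fun z : Site 2 => z ∈ farFrom a b w h d)
    (N' := fun z : Site 2 => a - d - 1 ≤ z 0 ∧ z 0 ≤ a + w + d)
    (B := fun z : Site 2 => a ≤ z 0 ∧ z 0 < a + w ∧ b ≤ z 1 ∧ z 1 < b + h)
    (fun z hz => by
      simp only [farFrom, Set.mem_setOf_eq] at hz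
      omega)
    (fun z z' hzz' hz => by
      have hc := frsw_cellGraph_adj_coord hzz'
      simp only [farFrom, Set.mem_setOf_eq] at hz
      omega)
    (fun z hz hzF => by
      simp only [farFrom, Set.mem_setOf_eq] at hzF
      omega)
    hp.2.1 hu huB hv hvF
  have hqx : q ∈ monoPaths x false := ⟨hqne, hqc, fun z hz => hp.2.2 z (hqsub z hz)⟩
  refine ⟨q, Lift.monoPaths_congr hxy (fun z hz => ?_) hqx, hqB, hqF⟩
  have hz' := hqN z hz
  simp only [colStrip, Set.mem_setOf_eq, Pi.add_apply, Matrix.cons_val_zero]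
  omega

/-- THE RING EVENT AT SCALE `d` IS DETERMINED BY THE COLUMN STRIP `a-d-1 … a+w+d`: "no white path from the
`w × h` box at `(a, b)` reaches `farFrom a b w h d`" reads only the cells and faces of
`colStrip (a-d-1) (a+w+d)`. [folklore] -/
theorem ring_mem_determinedOn_colStrip (a b : ℤ) (w h d : ℕ) :
    {x : Obs | ∀ p ∈ monoPaths x false, (∃ u ∈ p, a ≤ u 0 ∧ u 0 < a + w ∧ b ≤ u 1 ∧ u 1 < b + h) →
        ∀ v ∈ p, v ∉ farFrom a b w h d} ∈ determinedOn (colStrip (a - d - 1) (a + w + d)) := by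
  intro x y hxy
  have hxy' : Lift.Agree (colStrip (a - d - 1) (a + w + d)) x y := hxy
  constructor
  · intro hx p hp hpB v hv hvF
    obtain ⟨p', hp', hp'B, v', hv', hv'F⟩ :=
      ring_witness_transfer_colStrip hxy'.symm ⟨p, hp, hpB, v, hv, hvF⟩
    exact hx p' hp' hp'B v' hv' hv'F
  · intro hy p hp hpB v hv hvF
    obtain ⟨p', hp', hp'B, v', hv', hv'F⟩ :=
      ring_witness_transfer_colStrip hxy' ⟨p, hp, hpB, v, hv, hvF⟩
    exact hy p' hp' hp'B v' hv' hv'F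

/-! ## §2 Measurability and the strip transfer -/

/-- THE RING EVENT IS MEASURABLE: it is determined by the finite box `[a-d-2, a+w+d+2) × [b-d-2, b+h+d+2)`
(`farRSW_ring_mem_determinedOn`). [folklore] -/
theorem ring_measurableSet (a b : ℤ) (w h d : ℕ) :
    MeasurableSet {x : Obs | ∀ p ∈ monoPaths x false,
      (∃ u ∈ p, a ≤ u 0 ∧ u 0 < a + w ∧ b ≤ u 1 ∧ u 1 < b + h) → ∀ v ∈ p, v ∉ farFrom a b w h d} :=
  frsw_measurableSet_of_determinedOn_box (a - d - 2) (b - d - 2) (w + 2 * d + 4) (h + 2 * d + 4)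
    (farRSW_ring_mem_determinedOn a b w h d)

/-- STRIP TRANSFER: if the columns `a-d-1 … a+w+d` are honeycomb in `S`, the ring event at scale `d` of the
`w × h` box at `(a, b)` has the same probability under `ν_S` and under `ν_∅` (`stripLaw`). [folklore] -/
theorem ring_nuMix_eq_of_hon (S : Set ℤ) (a b : ℤ) (w h d : ℕ)
    (hS : ∀ x : ℤ, a - d - 1 ≤ x → x ≤ a + w + d → x ∉ S) :
    νmix S {x : Obs | ∀ p ∈ monoPaths x false,
        (∃ u ∈ p, a ≤ u 0 ∧ u 0 < a + w ∧ b ≤ u 1 ∧ u 1 < b + h) → ∀ v ∈ p, v ∉ farFrom a b w h d} =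
      νmix ∅ {x : Obs | ∀ p ∈ monoPaths x false,
        (∃ u ∈ p, a ≤ u 0 ∧ u 0 < a + w ∧ b ≤ u 1 ∧ u 1 < b + h) → ∀ v ∈ p, v ∉ farFrom a b w h d} :=
  stripLaw S ∅ (a - d - 1) (a + w + d)
    (fun j h1 h2 => ⟨fun hj => (hS j h1 h2 hj).elim, fun hj => hj.elim⟩)
    _ (ring_measurableSet a b w h d) (ring_mem_determinedOn_colStrip a b w h d)

/-! ## §3 The registered sub-goal -/

/-- **THE RING CLAUSE OF `stub_IKFarRSW` ON HONEYCOMB STRIPS, EVERY ASPECT BOUND** (registered sub-goal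
`ikFarRSW_ring_hon` of stmt-CriticalPhenomena-5076): for every `k` there is `c > 0` such that for every column
pattern `S`, every `n ≥ 1`, every position `(a, b)` and every `w × h` box with `n ≤ w ≤ k n`, `n ≤ h ≤ k n`
whose columns `a-n-1 … a+w+n` are honeycomb (`∉ S`), with `ν_S`-probability at least `c` every white
monochromatic path meeting the box `[a, a+w) × [b, b+h)` stays off `farFrom a b w h n`. Proof: the ring
event is determined by the column strip `a-n-1 … a+w+n` (`ring_mem_determinedOn_colStrip`), so its
`ν_S`-probability equals its `ν_∅`-probability (`ring_nuMix_eq_of_hon`, i.e. `stripLaw`), which is bounded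
below by the constant of `ikFarRSW_ring_empty k`. [folklore] -/
theorem ikFarRSW_ring_hon : ∀ k : ℕ, ∃ c : ℝ, 0 < c ∧ ∀ (S : Set ℤ) (n : ℕ) (a b : ℤ) (w h : ℕ), 1 ≤ n → n ≤ w → w ≤ k * n → n ≤ h → h ≤ k * n → (∀ x : ℤ, a - n - 1 ≤ x → x ≤ a + w + n → x ∉ S) → c ≤ (νmix S).real {x | ∀ p ∈ monoPaths x false, (∃ u ∈ p, a ≤ u 0 ∧ u 0 < a + w ∧ b ≤ u 1 ∧ u 1 < b + h) → ∀ v ∈ p, v ∉ farFrom a b w h n} := by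
  intro k
  obtain ⟨c, hc, hring⟩ := ikFarRSW_ring_empty k
  refine ⟨c, hc, fun S n a b w h hn hnw hwk hnh hhk hS => ?_⟩
  rw [measureReal_def, ring_nuMix_eq_of_hon S a b w h n hS, ← measureReal_def]
  exact hring n a b w h hn hnw hwk hnh hhk

end Summit.CriticalPhenomena.CardyFormulaZ2.Theorems.IKLinearTransport.PinnedDiagramExchange.FarRSWFragments

end
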